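import Summits.CriticalPhenomena.PercolationContinuityZ3.Theorems.Transplant.CayleyNilpotentSigns
import Mathlib.GroupTheory.FreeGroup.Basic
import Mathlib.GroupTheory.Nilpotent
import HarnessLib

/-!
# `θ(p_c) = 0` on the free nilpotent groups `N_{r,c}` of EVERY rank `r ≥ 2` and EVERY class `c ≥ 1`

builds on p205010 (kernel theorem, internal audit signed; external expert review pending).
Lane `prim-bschramm`, seat `prim-bschramm-p4` gen 10 (PART C3, tier 2′ of `P4-GENERAL.md` §28).  Helper file
(`--supports stmt-CriticalPhenomena-4575 --as helper`).

The free nilpotent group of rank `m + 2` and class `c + 1` is `N m c := F ⧸ γ_{c+2}(F)`, `F = FreeGroup (Fin (m+2))`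
(Mathlib indexing: `(⊤ : Subgroup F).lowerCentralSeries (c + 1)`).  It is a customer of `NilSigns.SignData` (file `CayleyNilpotentSigns`):
letters `a_i^{±1}`, planar skeleton `φ = (exponent sum of a₀, exponent sum of a₁) : N → ℤ²`, sign automorphisms `ν : a_i ↦ a_i⁻¹` (all `i`)
and `κ : a₁ ↦ a₁⁻¹` (others fixed), which exist on `N` because `γ_{c+2}(F)` is characteristic and permute the letters.  The generating
system is `S` = letters together with ALL left-normed commutators `⁅a_{i₁}^{±1}, ⁅…, a_{i_k}^{±1}⁆…⁆` of weights `2 … c + 1`; the kernel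
criterion, the preservation of `S` and the `CayleySign₀` datum come from `NilSigns`.  Hence **`θ_g(p_c) = 0` for every `g`** — for `c ≥ 2`
these groups were listed under "NOT covered" in `P4-GENERAL.md` §9.3 (fibres of dimension `≥ 2`, point group only `(ℤ/2)²`), and `N_{2,3}`
was one of the two named examples of tier 2′ (§27 (4)(b)).
-/

namespace Summit.CriticalPhenomena.PercolationContinuityZ3.Theorems.Transplant

namespace FreeNilClass

open SimpleGraph Subgroup Literature.Probability.LatticeModels Literature.Probability.Percolation
open scoped commutatorElement

/-! ## §1 The group -/

/-- The free group on `m + 2` letters. [folklore] -/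
abbrev F (m : ℕ) : Type := FreeGroup (Fin (m + 2))

/-- `γ m c = γ_{c+2}(F)`, the `(c+1)`-st Mathlib term of the lower central series of `F`. [folklore] -/
abbrev γ (m c : ℕ) : Subgroup (F m) := (⊤ : Subgroup (F m)).lowerCentralSeries (c + 1)

/-- **The free nilpotent group `N_{m+2, c+1} = F_{m+2} ⧸ γ_{c+2}(F_{m+2})`** of rank `m + 2` and class `c + 1`. [folklore] -/
abbrev N (m c : ℕ) : Type := F m ⧸ γ m c

variable {m c : ℕ}

/-- The projection `F → N`. [folklore] -/
abbrev π (m c : ℕ) : F m →* N m c := QuotientGroup.mk' (γ m c)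

/-- `π` is surjective. [folklore] -/
theorem π_surjective : Function.Surjective (π m c) := QuotientGroup.mk'_surjective _

/-- **`N m c` has class `≤ c + 1`**: `γ_{c+2}(N) = 1`. [folklore] -/
theorem lowerCentralSeries_N_eq_bot (m c : ℕ) : (⊤ : Subgroup (N m c)).lowerCentralSeries (c + 1) = ⊥ := by
  have h := Subgroup.map_lowerCentralSeries (π m c) (S := ⊤) (c + 1)
  rw [Subgroup.map_top_of_surjective _ π_surjective] at h
  rw [← h]; exact QuotientGroup.map_mk'_self (γ m c)

/-- The letters `a_i^{±1}` of `F`. [folklore] -/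
def L (m : ℕ) : Finset (F m) :=
  Finset.univ.image (fun i : Fin (m + 2) => FreeGroup.of i) ∪ Finset.univ.image (fun i : Fin (m + 2) => (FreeGroup.of i)⁻¹)

/-- Membership in `L`. [folklore] -/
theorem mem_L {w : F m} : w ∈ L m ↔ ∃ i : Fin (m + 2), w = FreeGroup.of i ∨ w = (FreeGroup.of i)⁻¹ := by
  simp only [L, Finset.mem_union, Finset.mem_image, Finset.mem_univ, true_and]
  constructor
  · rintro (⟨i, rfl⟩ | ⟨i, rfl⟩) <;> [exact ⟨i, Or.inl rfl⟩; exact ⟨i, Or.inr rfl⟩]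
  · rintro ⟨i, rfl | rfl⟩ <;> [exact Or.inl ⟨i, rfl⟩; exact Or.inr ⟨i, rfl⟩]

/-- `L` is symmetric. [folklore] -/
theorem inv_mem_L {w : F m} (hw : w ∈ L m) : w⁻¹ ∈ L m := by
  obtain ⟨i, rfl | rfl⟩ := mem_L.1 hw <;> [exact mem_L.2 ⟨i, Or.inr rfl⟩; exact mem_L.2 ⟨i, Or.inl (inv_inv _)⟩]

/-- `L` generates `F`. [folklore] -/
theorem closure_L (m : ℕ) : Subgroup.closure (L m : Set (F m)) = ⊤ := by
  refine top_le_iff.1 ?_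
  rw [← FreeGroup.closure_range_of]
  exact Subgroup.closure_mono (by rintro _ ⟨i, rfl⟩; exact Finset.mem_coe.2 (mem_L.2 ⟨i, Or.inl rfl⟩))

/-! ## §2 The skeleton `φ` -/

/-- The height of a letter: `a₀ ↦ e₀`, `a₁ ↦ e₁`, the others `↦ 0`. [folklore] -/
def ht (i : Fin (m + 2)) : Site 2 := if i = 0 then Pi.single 0 1 else if i = 1 then Pi.single 1 1 else 0

/-- The skeleton on `F` as a homomorphism to `Multiplicative ℤ²`. [folklore] -/
def fF (m : ℕ) : F m →* Multiplicative (Site 2) := FreeGroup.lift fun i => Multiplicative.ofAdd (ht i)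

/-- `fF` on a letter. [folklore] -/
@[simp] theorem fF_of (i : Fin (m + 2)) : fF m (FreeGroup.of i) = Multiplicative.ofAdd (ht i) := by
  simp [fF]

/-- `γ ≤ ker fF` (the target is abelian and `c + 1 ≥ 1`). [folklore] -/
theorem γ_le_ker (m c : ℕ) : γ m c ≤ (fF m).ker := by
  refine le_trans (Subgroup.lowerCentralSeries_antitone ⊤ (Nat.le_add_left 1 c)) ?_
  rw [Subgroup.top_lowerCentralSeries_one]
  exact Abelianization.commutator_subset_ker _

/-- The skeleton on `N` as a homomorphism. [folklore] -/
def fN (m c : ℕ) : N m c →* Multiplicative (Site 2) := QuotientGroup.lift (γ m c) (fF m) (γ_le_ker m c)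

/-- `fN ∘ π = fF`. [folklore] -/
@[simp] theorem fN_π (w : F m) : fN m c (π m c w) = fF m w := rfl

/-- **The planar skeleton `φ : N_{m+2,c+1} → ℤ²`** (exponent sums of `a₀` and `a₁`). [cite: KozmaNitzan2024, §4 p. 16 (Lemma 8)] -/
def φ (m c : ℕ) (g : N m c) : Site 2 := Multiplicative.toAdd (fN m c g)

/-- `φ` is additive. [folklore] -/
theorem φ_mul (g h : N m c) : φ m c (g * h) = φ m c g + φ m c h := by
  simp only [φ, map_mul, toAdd_mul]

/-- `φ` of the image of a word. [folklore] -/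
theorem φ_π (w : F m) : φ m c (π m c w) = Multiplicative.toAdd (fF m w) := rfl

/-- `φ` of a letter. [folklore] -/
theorem φ_π_of (i : Fin (m + 2)) : φ m c (π m c (FreeGroup.of i)) = ht i := by
  rw [φ_π, fF_of]; rfl

/-- `φ` of an inverse letter. [folklore] -/
theorem φ_π_of_inv (i : Fin (m + 2)) : φ m c (π m c (FreeGroup.of i)⁻¹) = -ht i := by
  rw [φ_π, map_inv, fF_of]; rfl

/-! ## §3 The sign automorphisms -/

section Sign

variable (P : Fin (m + 2) → Prop) [DecidablePred P]

/-- The endomorphism of `F` inverting the letters in `P`. [folklore] -/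
def invHom : F m →* F m := FreeGroup.lift fun i => if P i then (FreeGroup.of i)⁻¹ else FreeGroup.of i

/-- `invHom` on a letter. [folklore] -/
theorem invHom_of (i : Fin (m + 2)) : invHom P (FreeGroup.of i) = if P i then (FreeGroup.of i)⁻¹ else FreeGroup.of i := by
  simp [invHom]

/-- `invHom` is an involution. [folklore] -/
theorem invHom_invHom (w : F m) : invHom P (invHom P w) = w := by
  have h : (invHom P).comp (invHom P) = MonoidHom.id (F m) := by
    refine FreeGroup.ext_hom _ _ fun i => ?_
    rw [MonoidHom.comp_apply, invHom_of]
    split_ifs with hi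
    · rw [map_inv, invHom_of, if_pos hi, inv_inv]; rfl
    · rw [invHom_of, if_neg hi]; rfl
  exact DFunLike.congr_fun h w

/-- `invHom` as an automorphism of `F`. [folklore] -/
def invEquiv : F m ≃* F m where
  toFun := invHom P
  invFun := invHom P
  left_inv := invHom_invHom P
  right_inv := invHom_invHom P
  map_mul' := map_mul _

/-- `invEquiv` preserves the characteristic subgroup `γ`. [folklore] -/
theorem map_invEquiv_γ : (γ m c).map ((invEquiv P : F m ≃* F m) : F m →* F m) = γ m c :=
  Subgroup.characteristic_iff_map_eq.1 inferInstance _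

/-- **The sign automorphism of `N` inverting the letters in `P`.** [cite: KozmaNitzan2024, §4 p. 16 (Lemma 8)] -/
def sgnAut : N m c ≃* N m c := QuotientGroup.congr (γ m c) (γ m c) (invEquiv P) (map_invEquiv_γ P)

/-- `sgnAut` on the image of a word. [folklore] -/
theorem sgnAut_π (w : F m) : sgnAut P (π m c w) = π m c (invHom P w) := rfl

/-- `sgnAut` is an involution. [folklore] -/
theorem sgnAut_sgnAut (g : N m c) : sgnAut P (sgnAut P g) = g := by
  obtain ⟨w, rfl⟩ := π_surjective g
  rw [sgnAut_π, sgnAut_π, invHom_invHom]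

/-- `invHom` preserves the letters. [folklore] -/
theorem invHom_mem_L {w : F m} (hw : w ∈ L m) : invHom P w ∈ L m := by
  obtain ⟨i, rfl | rfl⟩ := mem_L.1 hw
  · rw [invHom_of]; split_ifs <;> [exact mem_L.2 ⟨i, Or.inr rfl⟩; exact mem_L.2 ⟨i, Or.inl rfl⟩]
  · rw [map_inv, invHom_of]; split_ifs <;> [(rw [inv_inv]; exact mem_L.2 ⟨i, Or.inl rfl⟩); exact mem_L.2 ⟨i, Or.inr rfl⟩]

end Sign

/-- `ν`: invert every letter. [folklore] -/
def ν (m c : ℕ) : N m c ≃* N m c := sgnAut (fun _ : Fin (m + 2) => True)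

/-- `κ`: invert the letter `a₁` only. [folklore] -/
def κ (m c : ℕ) : N m c ≃* N m c := sgnAut (fun i : Fin (m + 2) => i = 1)

/-- `fF ∘ invHom(all) = inversion ∘ fF`. [folklore] -/
theorem fF_invHom_all (w : F m) : fF m (invHom (fun _ : Fin (m + 2) => True) w) = (fF m w)⁻¹ := by
  have h : (fF m).comp (invHom (fun _ : Fin (m + 2) => True)) = invMonoidHom.comp (fF m) := by
    refine FreeGroup.ext_hom _ _ fun i => ?_
    rw [MonoidHom.comp_apply, invHom_of, if_pos trivial, map_inv, MonoidHom.comp_apply]; rfl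
  exact DFunLike.congr_fun h w

/-- **`φ ∘ ν = −φ`.** [folklore] -/
theorem φ_ν (g : N m c) : φ m c (ν m c g) = -φ m c g := by
  obtain ⟨w, rfl⟩ := π_surjective g
  rw [ν, sgnAut_π, φ_π, φ_π, fF_invHom_all, toAdd_inv]

/-- `flipSnd` is additive. [folklore] -/
theorem flipSnd_add (y z : Site 2) : flipSnd (y + z) = flipSnd y + flipSnd z := by
  funext j; simp only [flipSnd, Pi.add_apply]; split_ifs <;> ring

/-- `flipSnd` as a homomorphism of `Multiplicative ℤ²`. [folklore] -/
def flipSndHom : Multiplicative (Site 2) →* Multiplicative (Site 2) :=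
  AddMonoidHom.toMultiplicative ⟨⟨flipSnd, by funext j; simp [flipSnd]⟩, flipSnd_add⟩

/-- `flipSndHom` evaluated. [folklore] -/
theorem toAdd_flipSndHom (y : Multiplicative (Site 2)) : Multiplicative.toAdd (flipSndHom y) = flipSnd (Multiplicative.toAdd y) := rfl

/-- `flipSnd` on heights of letters: only `a₁` flips. [folklore] -/
theorem flipSnd_ht (i : Fin (m + 2)) : flipSnd (ht i) = if i = 1 then -ht i else ht i := by
  unfold ht flipSnd
  funext j
  fin_cases j <;> simp only [Fin.zero_eta, Fin.isValue, Fin.mk_one] <;> split_ifs <;> simp_all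

/-- `fF ∘ invHom(a₁) = flipSnd ∘ fF`. [folklore] -/
theorem fF_invHom_one (w : F m) :
    fF m (invHom (fun i : Fin (m + 2) => i = 1) w) = flipSndHom (fF m w) := by
  have h : (fF m).comp (invHom (fun i : Fin (m + 2) => i = 1)) = flipSndHom.comp (fF m) := by
    refine FreeGroup.ext_hom _ _ fun i => ?_
    rw [MonoidHom.comp_apply, invHom_of, MonoidHom.comp_apply, fF_of]
    apply Multiplicative.toAdd.injective
    rw [toAdd_flipSndHom, toAdd_ofAdd, flipSnd_ht]
    split_ifs with hi
    · rw [map_inv, fF_of, toAdd_inv, toAdd_ofAdd]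
    · rw [fF_of, toAdd_ofAdd]
  exact DFunLike.congr_fun h w

/-- **`φ ∘ κ = flipSnd ∘ φ`.** [folklore] -/
theorem φ_κ (g : N m c) : φ m c (κ m c g) = flipSnd (φ m c g) := by
  obtain ⟨w, rfl⟩ := π_surjective g
  rw [κ, sgnAut_π, φ_π, φ_π, fF_invHom_one, toAdd_flipSndHom]

/-! ## §4 The letters downstairs and the `SignData` -/

/-- The letters downstairs, as a `Finset` of `N`. [folklore] -/
noncomputable def AL (m c : ℕ) : Finset (N m c) := ((L m).finite_toSet.image (π m c)).toFinset

/-- Membership in `AL`. [folklore] -/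
theorem mem_AL {a : N m c} : a ∈ AL m c ↔ ∃ w ∈ L m, π m c w = a := by
  rw [AL, Set.Finite.mem_toFinset, Set.mem_image]; simp only [Finset.mem_coe]

/-- `AL` as a set is the image of the letters. [folklore] -/
theorem coe_AL : (AL m c : Set (N m c)) = π m c '' (L m : Set (F m)) := by
  ext a; rw [Finset.mem_coe, mem_AL, Set.mem_image]; simp only [Finset.mem_coe]

/-- The letters downstairs generate. [folklore] -/
theorem closure_AL : Subgroup.closure (AL m c : Set (N m c)) = ⊤ := by
  rw [coe_AL, ← MonoidHom.map_closure, closure_L, Subgroup.map_top_of_surjective _ π_surjective]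

/-- The letters downstairs are symmetric. [folklore] -/
theorem inv_mem_AL {a : N m c} (ha : a ∈ AL m c) : a⁻¹ ∈ AL m c := by
  obtain ⟨w, hw, rfl⟩ := mem_AL.1 ha
  exact mem_AL.2 ⟨w⁻¹, inv_mem_L hw, map_inv _ _⟩

/-- `sgnAut` permutes the letters downstairs. [folklore] -/
theorem sgnAut_mem_AL (P : Fin (m + 2) → Prop) [DecidablePred P] (a : N m c) : sgnAut P a ∈ AL m c ↔ a ∈ AL m c := by
  have key : ∀ a : N m c, a ∈ AL m c → sgnAut P a ∈ AL m c := by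
    intro a ha
    obtain ⟨w, hw, rfl⟩ := mem_AL.1 ha
    rw [sgnAut_π]; exact mem_AL.2 ⟨_, invHom_mem_L P hw, rfl⟩
  refine ⟨fun h => ?_, key a⟩
  have := key _ h
  rwa [sgnAut_sgnAut] at this

/-- Every letter downstairs is in `ker φ` or among `a₀^{±1}, a₁^{±1}`. [folklore] -/
theorem AL_cases {a : N m c} (ha : a ∈ AL m c) :
    φ m c a = 0 ∨ a = π m c (FreeGroup.of 0) ∨ a = (π m c (FreeGroup.of 0))⁻¹ ∨ a = π m c (FreeGroup.of 1) ∨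
      a = (π m c (FreeGroup.of 1))⁻¹ := by
  obtain ⟨w, hw, rfl⟩ := mem_AL.1 ha
  obtain ⟨i, rfl | rfl⟩ := mem_L.1 hw
  · by_cases h0 : i = 0; · subst h0; exact Or.inr (Or.inl rfl)
    by_cases h1 : i = 1; · subst h1; exact Or.inr (Or.inr (Or.inr (Or.inl rfl)))
    exact Or.inl (by rw [φ_π_of]; simp [ht, h0, h1])
  · by_cases h0 : i = 0; · subst h0; exact Or.inr (Or.inr (Or.inl (map_inv _ _)))
    by_cases h1 : i = 1; · subst h1; exact Or.inr (Or.inr (Or.inr (Or.inr (map_inv _ _))))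
    exact Or.inl (by rw [φ_π_of_inv]; simp [ht, h0, h1])

/-- **THE `SignData` OF `N_{m+2,c+1}`**: letters, skeleton `(x₀, x₁)`, `ν`, `κ`; class `≤ c + 1`. [cite: KozmaNitzan2024, §4 p. 16 (Lemma 8)] -/
noncomputable def signData (m c : ℕ) : NilSigns.SignData (N m c) where
  A := AL m c
  symm := fun _ => inv_mem_AL
  gen := closure_AL
  c := c
  nil := lowerCentralSeries_N_eq_bot m c
  φ := φ m c
  map_mul := φ_mul
  x := π m c (FreeGroup.of 0)
  x_mem := mem_AL.2 ⟨_, mem_L.2 ⟨0, Or.inl rfl⟩, rfl⟩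
  φ_x := by rw [φ_π_of]; rfl
  y := π m c (FreeGroup.of 1)
  y_mem := mem_AL.2 ⟨_, mem_L.2 ⟨1, Or.inl rfl⟩, rfl⟩
  φ_y := by rw [φ_π_of]; rfl
  letters := fun _ => AL_cases
  ν := ν m c
  ν_mem := sgnAut_mem_AL _
  ν_φ := φ_ν
  κ := κ m c
  κ_mem := sgnAut_mem_AL _
  κ_φ := φ_κ

/-- **The generating system `S` of `N_{m+2,c+1}`**: the letters `a_i^{±1}` and all left-normed commutators of letters of weights `2 … c + 1`
(`NilSigns.SignData.S`; membership `NilSigns.SignData.mem_S`). [folklore] -/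
noncomputable abbrev S (m c : ℕ) : Finset (N m c) := (signData m c).S

/-- **THEOREM (tier 2′, unconditional): `θ_g(p_c) = 0` at every vertex of the Cayley graph of the free nilpotent group `N_{m+2,c+1}` of
EVERY rank `≥ 2` and EVERY class `≥ 1`**, with respect to the letters and the left-normed commutators of letters of weights `≤ c + 1`.  For
class `≥ 3` the cylinders of the skeleton have fibres `ker φ ⊇ γ₂(N)` of Hirsch length growing with `c` and no centralised skeleton
translation exists; Φ2 at `p_c` comes from the graph–subgraph strict inequality (`SubStrict.Setup.criticalProb_lt`).
builds on p205010 (kernel theorem, internal audit signed; external expert review pending).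
[cite: BenjaminiSchramm1996, Conj. 4] [cite: AizenmanGrimmett1991, Thm 1] [cite: KozmaNitzan2024, §1 p. 2 (approach 1)] -/
theorem theta_criticalProb_freeNilClass (m c : ℕ) (g : N m c) :
    theta (mulCayley (↑(S m c) : Set (N m c))) g (criticalProbIOf (mulCayley (↑(S m c) : Set (N m c))) g) = 0 :=
  (signData m c).criticalContinuity g

end FreeNilClass

end Summit.CriticalPhenomena.PercolationContinuityZ3.Theorems.Transplant
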